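import Mathlib
import Summits.CriticalPhenomena.PercolationContinuityZ3.Theses.PercBurnResprinkle

/-!
# Sketch — crux-ideate stmt-CriticalPhenomena-7203 (VacantReignition), ideator 3, round 1

First lemmas of the idea cards `holes-are-fresh` and `slab-slice-avoidability`, stated over existing declarations
(`labelMeasure`, `configOfLabels`, `openCluster`, `openGraph`, `criticalProb`, `zdGraph`,
route decl `PercBurnResprinkle.VacantReignition`).  Nothing is proved here.
-/

noncomputable section

namespace Summit.CriticalPhenomena.PercolationContinuityZ3.Cruxes.VacantReignition.Sketch

open MeasureTheory Literature.Probability.Percolation Literature.Probability.LatticeModels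
open Summit.CriticalPhenomena.PercolationContinuityZ3.Theses.PercBurnResprinkle

/-- vertices of `ℤ³` -/
abbrev V3 : Type := Fin 3 → ℤ

/-- a pair of label fields `π = (U, U')` : environment labels `U = π.1`, fresh labels `U' = π.2` -/
abbrev LabelPair : Type := (Sym2 V3 → ℝ) × (Sym2 V3 → ℝ)

/-- the product law `labelMeasure ⊗ labelMeasure` of two independent i.i.d.-uniform label fields -/
abbrev μ2 : Measure LabelPair := (labelMeasure V3).prod (labelMeasure V3)

/-- `p_c(ℤ³)` -/
abbrev pc : ℝ := criticalProb (zdGraph 3) (0 : V3)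

/-- the burnt set `I_p(U) = {y : C_{ω_p}(y) infinite}`, `ω_p = configOfLabels p U` -/
def burnt (p : ℝ) (U : Sym2 V3 → ℝ) : Set V3 :=
  {y | (openCluster (configOfLabels p U (zdGraph 3)) y).Infinite}

/-- vacant FRESH configuration: fresh `q`-open edges with both endpoints off `I_p(U)` (the crux's object) -/
def vacantFresh (p q : ℝ) (π : LabelPair) : BondConfig V3 :=
  {e | e ∈ configOfLabels q π.2 (zdGraph 3) ∧ ∀ y ∈ e, y ∉ burnt p π.1}

/-- vacant SAME-FIELD configuration: the environment's own `q`-open edges with both endpoints off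
`I_p(U)` (Ahlberg–Duminil-Copin–Kozma–Sidoravicius, Thm 2 shape, vertex form) -/
def vacantSame (p q : ℝ) (U : Sym2 V3 → ℝ) : BondConfig V3 :=
  {e | e ∈ configOfLabels q U (zdGraph 3) ∧ ∀ y ∈ e, y ∉ burnt p U}

/-! ## Card `holes-are-fresh` (wired resampling identity) -/

/-- FIRST LEMMA of card 1 (one-point form of the identity "the labels off the infinite cluster are
fresh"): fresh and same-field vacant percolation from the origin have the same probability, for
all levels `p, q`. -/
def HolesAreFreshOnePoint : Prop :=
  ∀ p q : ℝ, μ2 {π | (openCluster (vacantFresh p q π) (0 : V3)).Infinite}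
    = (labelMeasure V3) {U | (openCluster (vacantSame p q U) (0 : V3)).Infinite}

/-- Free corollary (tightness lemma for the crux and for JumpFireBreak): the WEAK fire-break
`p_c(ℤ³ ∖ I_p) ≥ p` — fresh Bernoulli(`p`) percolation on the vacant set of level `p` is null,
for EVERY `p` (so a witness `p` of `VacantReignition ε` lies in `(p_c, p_c + ε)`). -/
def WeakFireBreak : Prop :=
  ∀ p : ℝ, μ2 {π | (openCluster (vacantFresh p p π) (0 : V3)).Infinite} = 0

/-- Same-field re-ignition = ADKS 2015 Thm 2 for `d = 3` (vertex-deleted form). -/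
def SameFieldReignition : Prop :=
  ∀ ε : ℝ, 0 < ε → ∃ p : ℝ, pc < p ∧
    0 < (labelMeasure V3).real {U | (openCluster (vacantSame p (pc + ε) U) (0 : V3)).Infinite}

/-- TRANSFER statement of card 1: the crux is literally the `d = 3` case of ADKS Thm 2. -/
def Transfer_holesAreFresh : Prop :=
  HolesAreFreshOnePoint → (SameFieldReignition ↔ VacantReignition)

/-! ## Card `slab-section-avoidability` (finite-size criterion in a Grimmett–Marstrand slab) -/

/-- planar sup-norm `max(|x₁|,|x₂|)` (coordinate `0` is the thin direction of the slab) -/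
def pnorm (x : V3) : ℤ := max |x 1| |x 2|

/-- centred slab of half-thickness `ℓ` in direction `0` -/
def cslab (ℓ : ℕ) : Set V3 := {x | |x 0| ≤ (ℓ : ℤ)}

/-- one-arm set `J_L(ω)`: vertices joined by an open path to sup-distance `≥ L` from themselves
(a LOCAL superset of the burnt set: `burnt p U ⊆ oneArm L (configOfLabels p U _)`). -/
def oneArm (L : ℕ) (ω : BondConfig V3) : Set V3 :=
  {y | ∃ z : V3, (openGraph ω).Reachable y z ∧ ∃ i : Fin 3, (L : ℤ) ≤ |z i - y i|}

/-- the perforated fresh slab-block configuration: fresh `q`-open edges inside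
`cslab ℓ ∩ {pnorm ≤ 3L}` with both endpoints off `J_L(ω_p)` (ADKS's `ω^S` with `S := J_L`). -/
def slabBlock (ℓ L : ℕ) (p q : ℝ) (π : LabelPair) : BondConfig V3 :=
  {e | e ∈ configOfLabels q π.2 (zdGraph 3) ∧
    ∀ y ∈ e, y ∈ cslab ℓ ∧ pnorm y ≤ 3 * (L : ℤ) ∧ y ∉ oneArm L (configOfLabels p π.1 (zdGraph 3))}

/-- GOOD block (ADKS event `𝓑` with the deleted set the actual one-arm set instead of "every
`M`-subset"): a perforated fresh crossing from `{pnorm ≤ L}` to `{pnorm = 3L}` inside the slab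
block, and uniqueness of perforated clusters of planar radius `≥ L` in the block. A LOCAL event
(depends on labels in `{pnorm ≤ 4L} ∩ cslab (ℓ + L)`), increasing in `π.2`, decreasing in `π.1`. -/
def GoodBlock (ℓ L : ℕ) (p q : ℝ) : Set LabelPair :=
  {π | (∃ x y : V3, pnorm x ≤ (L : ℤ) ∧ pnorm y = 3 * (L : ℤ) ∧
          (openGraph (slabBlock ℓ L p q π)).Reachable x y) ∧
       (∀ x y x' y' : V3, (openGraph (slabBlock ℓ L p q π)).Reachable x y →
          (openGraph (slabBlock ℓ L p q π)).Reachable x' y' →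
          (L : ℤ) ≤ pnorm (y - x) → (L : ℤ) ≤ pnorm (y' - x') →
          (openGraph (slabBlock ℓ L p q π)).Reachable x x')}

/-- The finite-size criterion at fresh level `p_c + ε`: some slab thickness, some block scale and
some environment level `p > p_c` make the good block `(1-η)`-likely. (By continuity of the
polynomial `p ↦ μ2 (GoodBlock ℓ L p q)` it suffices to have `> 1 - η` AT `p = p_c`.) -/
def SlabAvoidCriterion (η ε : ℝ) : Prop :=
  ∃ ℓ L : ℕ, 0 < L ∧ ∃ p : ℝ, pc < p ∧ 1 - η ≤ μ2.real (GoodBlock ℓ L p (pc + ε))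

/-- FIRST LEMMA of card 2 (ADKS-in-a-slab with avoidability replacing fewness): there is a
universal `η > 0` (8-dependent planar site percolation, Liggett–Schonmann–Stacey) such that the
criterion at `ε` gives re-ignition at `ε` with the same witness `p`. -/
def CriterionGivesReignition : Prop :=
  ∃ η : ℝ, 0 < η ∧ ∀ ε : ℝ, 0 < ε → SlabAvoidCriterion η ε →
    ∃ p : ℝ, pc < p ∧ 0 < μ2.real {π | (openCluster (vacantFresh p (pc + ε) π) (0 : V3)).Infinite}

/-- … hence the crux, if the criterion holds for every `ε`. -/
def CriterionGivesCrux : Prop :=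
  (∃ η : ℝ, 0 < η ∧ ∀ ε : ℝ, 0 < ε → SlabAvoidCriterion η ε) → VacantReignition

/-- The premise the criterion rests on (numerically testable, kit job): planar SLICE
SUBCRITICALITY of the critical one-arm set — the `g`-dilated section `{z : z 0 = 0} ∩ J_L(ω_{p_c})`
has exponentially decaying planar `*`-connectivity, uniformly in `L ≥ L₀(g)`.  Stated through the
diameter of the planar `*`-component of the origin (`*`-adjacency = sup-distance `1` in the plane,
after dilating by `g`). -/
def SliceSubcritical : Prop :=
  ∀ g : ℕ, ∃ L₀ : ℕ, ∃ C c : ℝ, 0 < c ∧ ∀ L : ℕ, L₀ ≤ L → ∀ n : ℕ,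
    (labelMeasure V3).real {U |
      ∃ γ : List V3, γ ≠ [] ∧ γ.head? = some 0 ∧
        (∃ w ∈ γ, (n : ℤ) ≤ pnorm w) ∧
        (∀ w ∈ γ, w 0 = 0 ∧ ∃ v ∈ oneArm L (configOfLabels pc U (zdGraph 3)), v 0 = 0 ∧ pnorm (v - w) ≤ (g : ℤ)) ∧
        List.IsChain (fun a b => pnorm (a - b) ≤ 1) γ}
      ≤ C * Real.exp (-c * n)

/-- `g`-dilated planar slice of the one-arm set at level `p`: plane points within planar distance
`g` of a point of `J_L(ω_p) ∩ {x₀ = 0}`. -/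
def dilSlice (g L : ℕ) (p : ℝ) (U : Sym2 V3 → ℝ) : Set V3 :=
  {w | w 0 = 0 ∧ ∃ v ∈ oneArm L (configOfLabels p U (zdGraph 3)), v 0 = 0 ∧ pnorm (v - w) ≤ (g : ℤ)}

/-- planar `*`-chain (consecutive points at planar sup-distance `≤ 1`) inside the dilated slice,
from `a` to `b`, staying in `{pnorm ≤ n}` -/
def SliceConn (g L : ℕ) (p : ℝ) (U : Sym2 V3 → ℝ) (a b : V3) (n : ℕ) : Prop :=
  ∃ γ : List V3, γ.head? = some a ∧ γ.getLast? = some b ∧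
    List.IsChain (fun u v => pnorm (u - v) ≤ 1) γ ∧ ∀ w ∈ γ, w ∈ dilSlice g L p U ∧ pnorm w ≤ (n : ℤ)

/-- SECOND LEMMA of card 2 (Hammersley/Simon–Lieb finite-size criterion for slice subcriticality,
via the van den Berg–Kesten inequality for the increasing local events `w ∈ dilSlice`, whose witnesses
live in `B_w(L+g)`; the buffer `2L+2g+2` makes inner and outer witnesses disjoint): if at ONE scale `n`
the expected number of slice-connections from `0` to the planar sphere of radius `n` is `< 1/(8(n+2L+2g+2))`,
slice connectivity decays exponentially.  Provable now (M/L-sized), for every level `p`. -/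
def SliceHammersley : Prop :=
  ∀ (g L n : ℕ) (p : ℝ),
    (8 * ((n : ℝ) + 2 * L + 2 * g + 2)) *
      (∑ x ∈ (Literature.Probability.LatticeModels.box 3 n).filter (fun x => x 0 = 0 ∧ pnorm x = n),
        (labelMeasure V3).real {U | SliceConn g L p U 0 x n}) < 1 →
    ∃ C c : ℝ, 0 < c ∧ ∀ m : ℕ,
      (labelMeasure V3).real {U | ∃ x : V3, (m : ℤ) ≤ pnorm x ∧ SliceConn g L p U 0 x m} ≤ C * Real.exp (-c * m)

/-! ## Pendant decomposition (used by card `holes-are-fresh`, Transfer/First-lemma companions) -/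

/-- the burning level `m(v) = inf {p : v ∈ I_p}` of a vertex in the monotone coupling -/
def burningLevel (U : Sym2 V3 → ℝ) (v : V3) : ℝ := sInf {p : ℝ | v ∈ burnt p U}

/-- Pendant decomposition at `(p, q)`: every `q`-open path to infinity meets `I_p` — the exact
negation shape of same-field re-ignition at `(p,q)` (all vacant same-field clusters finite). -/
def PendantDecomposition (p q : ℝ) : Prop :=
  ∀ᵐ U ∂(labelMeasure V3), ∀ x : V3, (openCluster (vacantSame p q U) x).Finite

/-- Companion lemma of card 1: failure of the crux at `ε` forces pendant decomposition at every level
`p ∈ (p_c, p_c + ε)`, i.e. along every `(p_c+ε)`-open self-avoiding ray the burning levels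
accumulate at `p_c` (uses card 1's identity + monotonicity + ergodicity). -/
def NoReignitionForcesPendants : Prop :=
  HolesAreFreshOnePoint → ∀ ε : ℝ, 0 < ε →
    (¬ ∃ p : ℝ, pc < p ∧ 0 < μ2.real {π | (openCluster (vacantFresh p (pc + ε) π) (0 : V3)).Infinite}) →
    ∀ p : ℝ, pc < p → p < pc + ε → PendantDecomposition p (pc + ε)

end Summit.CriticalPhenomena.PercolationContinuityZ3.Cruxes.VacantReignition.Sketch
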